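import Summits.KontsevichZagierPeriods.KontsevichZagierPeriods.Theses.IsogenyCertificates
import Summits.KontsevichZagierPeriods.KontsevichZagierPeriods.Theorems.XMapKernel.Negative.Core
import Summits.KontsevichZagierPeriods.KontsevichZagierPeriods.Theorems.IsogenyCertificatesXMapPeriodTransfer
import Summits.KontsevichZagierPeriods.KontsevichZagierPeriods.Theorems.IsogenyCertificatesXMapKernelRealPeriodCell

/-!
# `XMapKernel` (stmt-KontsevichZagierPeriods-10663, route IsogenyCertificates) IS the summit; every line's
remainder is the summit given its cell (lead prover c2, line inventory closure)

The crux `XMapKernel` (kernel conjecture of the KZ calculus enlarged by the x-map period relators) is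
EQUIVALENT to the summit statement `KontsevichZagierPeriods`, unconditionally: Disproof F1
(`XMapKernel.Negative.iff_summit_of_transfer`, p76477) composed with the PROVED sibling crux
`XMapPeriodTransferCells.XMapPeriodTransfer_of` (item 10665). Consequently the enlarged move group
`closure gens` is just `KZ.relations`, and for EVERY sector `S ≤ FormalRep` whose cell is known
("kernel elements of `S` are relations") the off-cell reduction "every kernel element is congruent modulo
`closure gens` to an element of `S`" is again equivalent to the crux, i.e. to the summit
(`reduction_iff_xMapKernel_of_cell`, `reduction_iff_summit_of_cell`).

Instantiated VERBATIM for the registered remainder stubs of the crux's lines: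
* line `isogeny-orbit-collapse` (lead 0): `stub_reductionToRealPeriodSector ↔ KontsevichZagierPeriods` given the
  named fact `HuberWustholzManyCurvePeriods` (its cell is `XMapKernelRealPeriodCell.realPeriodCellKernel`, p95323):
  `reductionToRealPeriodSector_iff_summit`;
* line `axiom-saturated-sector-peeling` (lead c2): its cell `EllipticSectorXMapKernel` (sector `[{P>0}, a/√P]`,
  `a ∈ ℚ_{>0}`) is a corollary of the same landed cell (`ellipticSectorKernel`), its remainder
  `KernelModElliptic` follows from the crux unconditionally (`kernelModElliptic_of_xMapKernel`) and implies it
  given the cell (`xMapKernel_of_kernelModElliptic`): `kernelModElliptic_iff_summit`.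
(The (ω,η)-egg line `derived-datum-quasi-periods` is instantiated in
`IsogenyCertificatesXMapKernelEtaCell.lean`, which assembles that cell.)

No statement of the tree is changed; theorems only.
-/

noncomputable section

namespace Summit.KontsevichZagierPeriods.IsogenyCertificates.XMapKernelIffSummit

open Literature.NumberTheory.Transcendental
open Summit.KontsevichZagierPeriods.KontsevichZagierPeriods.Theses.IsogenyCertificates
open Summit.KontsevichZagierPeriods.XMapKernel.Negative
open Summit.KontsevichZagierPeriods.IsogenyCertificates (XMapPeriodTransferCells.XMapPeriodTransfer_of)
open Set

/-! ## The crux is the summit, unconditionally -/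

/-- **`XMapKernel ↔ KontsevichZagierPeriods`** — the crux of route IsogenyCertificates is the summit,
unconditionally (Disproof F1 ∘ the proved x-map period transfer). [cite: KontsevichZagier2001, §1.2] -/
theorem xMapKernel_iff_summit : Summit.KontsevichZagierPeriods.KontsevichZagierPeriods.Theses.IsogenyCertificates.XMapKernel ↔ KontsevichZagierPeriods :=
  iff_summit_of_transfer XMapPeriodTransferCells.XMapPeriodTransfer_of

/-- `XMapKernel ↔ KZKernelConjecture` (kernel form of Conjecture 1), unconditionally. [folklore] -/
theorem xMapKernel_iff_kzKernelConjecture : XMapKernel ↔ KZKernelConjecture :=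
  iff_kzKernelConjecture_of_transfer XMapPeriodTransferCells.XMapPeriodTransfer_of

/-- The x-map period relators are honest relations (the transfer, as a subset statement). [folklore] -/
theorem xMapRel_subset_relations : xMapRel ⊆ (KZ.relations : Set KZ.FormalRep) :=
  xMapRel_subset_relations_iff_transfer.2 XMapPeriodTransferCells.XMapPeriodTransfer_of

/-- The enlarged move group of the crux is the ordinary one: `closure gens = KZ.relations`. [folklore] -/
theorem closure_gens_eq_relations_holds : AddSubgroup.closure gens = KZ.relations :=
  closure_gens_eq_relations xMapRel_subset_relations

/-! ## Every line's remainder is the crux given its cell (arbitrary sector) -/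

/-- **Shape of every line.** For ANY subgroup `S` of formal combinations whose CELL is known (kernel
elements of `S` lie in `closure gens`), the off-cell reduction "every kernel element is congruent modulo
`closure gens` to an element of `S`" is EQUIVALENT to the crux: `←` with the sector element `0`; `→` by the
cell and soundness `closure_gens_le_ker_eval`. [folklore] -/
theorem reduction_iff_xMapKernel_of_cell (S : AddSubgroup KZ.FormalRep)
    (hC : ∀ c ∈ S, KZ.eval c = 0 → c ∈ AddSubgroup.closure gens) :
    (∀ c : KZ.FormalRep, KZ.eval c = 0 → ∃ c' ∈ S, c - c' ∈ AddSubgroup.closure gens) ↔ XMapKernel := by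
  rw [crux_iff]
  constructor
  · intro hK c hc
    obtain ⟨c', hc', hcc'⟩ := hK c hc
    have hdiff : KZ.eval (c - c') = 0 := AddMonoidHom.mem_ker.1 (closure_gens_le_ker_eval hcc')
    have hc'0 : KZ.eval c' = 0 := by
      rw [map_sub, hc, zero_sub, neg_eq_zero] at hdiff
      exact hdiff
    have : c = (c - c') + c' := by abel
    rw [this]
    exact AddSubgroup.add_mem _ hcc' (hC c' hc' hc'0)
  · intro hX c hc
    exact ⟨0, S.zero_mem, by simpa using hX c hc⟩

/-- … hence EQUIVALENT TO THE SUMMIT: no choice of sector makes the remainder of a cell-plus-reduction line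
on this crux weaker than the Kontsevich–Zagier period conjecture. [folklore] -/
theorem reduction_iff_summit_of_cell (S : AddSubgroup KZ.FormalRep)
    (hC : ∀ c ∈ S, KZ.eval c = 0 → c ∈ AddSubgroup.closure gens) :
    (∀ c : KZ.FormalRep, KZ.eval c = 0 → ∃ c' ∈ S, c - c' ∈ AddSubgroup.closure gens) ↔
      _root_.KontsevichZagierPeriods :=
  (reduction_iff_xMapKernel_of_cell S hC).trans xMapKernel_iff_summit

/-- The same with a cell into `KZ.relations` (the stronger form the (ω,η)-egg line proves). [folklore] -/
theorem reduction_iff_summit_of_cell_relations (S : AddSubgroup KZ.FormalRep)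
    (hC : ∀ c ∈ S, KZ.eval c = 0 → c ∈ KZ.relations) :
    (∀ c : KZ.FormalRep, KZ.eval c = 0 → ∃ c' ∈ S, c - c' ∈ AddSubgroup.closure gens) ↔
      _root_.KontsevichZagierPeriods :=
  reduction_iff_summit_of_cell S fun c hc h0 => relations_le_closure_gens (hC c hc h0)

/-! ## Line `isogeny-orbit-collapse`: its remainder K is the summit (given Huber–Wüstholz) -/

/-- **Line `isogeny-orbit-collapse`, remainder.** Conditionally on the named fact
`HuberWustholzManyCurvePeriods` (under which the real-period cell is a theorem, p95323), the registered stub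
`stub_reductionToRealPeriodSector` — reduction of every kernel element to the real-period sector
`[{x³+Ax+B>0}, a/√(x³+Ax+B)]`, `a ∈ ℚ` — is EQUIVALENT to the summit. [folklore] -/
theorem reductionToRealPeriodSector_iff_summit :
    Literature.NumberTheory.Transcendental.HuberWustholzManyCurvePeriods →
    ((∀ c : KZ.FormalRep, KZ.eval c = 0 → ∃ c' ∈ AddSubgroup.closure
      {d : KZ.FormalRep | ∃ (A B : ℤ) (a : ℚ) (r : KZ.IntegralRep 1), 4 * A ^ 3 + 27 * B ^ 2 ≠ 0 ∧
        r.domain = {x | 0 < x 0 ^ 3 + (A : ℝ) * x 0 + (B : ℝ)} ∧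
        Set.EqOn r.integrand (fun x => (a : ℝ) / Real.sqrt (x 0 ^ 3 + (A : ℝ) * x 0 + (B : ℝ))) r.domain ∧
        d = KZ.of r},
      c - c' ∈ AddSubgroup.closure Summit.KontsevichZagierPeriods.XMapKernel.Negative.gens) ↔
      _root_.KontsevichZagierPeriods) := fun hHW =>
  (XMapKernelRealPeriodCell.xMapKernel_iff_reduction hHW).symm.trans xMapKernel_iff_summit

/-! ## Line `axiom-saturated-sector-peeling`: cell (corollary of p95323) and remainder -/

/-- **Line `axiom-saturated-sector-peeling`, cell** (`EllipticSectorXMapKernel` of the idea card, in the tree's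
vocabulary): conditionally on `HuberWustholzManyCurvePeriods`, every element of value `0` of the subgroup
generated by the elliptic real-period representations `[{x³+Ax+B>0}, a/√(x³+Ax+B)]` with `a ∈ ℚ_{>0}` lies in
`closure gens` — a COROLLARY of the landed real-period cell (sector `a ∈ ℚ`) by monotonicity of the closure.
[cite: KontsevichZagier2001, §1.2] -/
theorem ellipticSectorKernel :
    Literature.NumberTheory.Transcendental.HuberWustholzManyCurvePeriods →
    ∀ e ∈ AddSubgroup.closure
      {d : KZ.FormalRep | ∃ (A B : ℤ) (a : ℚ) (r : KZ.IntegralRep 1), 4 * A ^ 3 + 27 * B ^ 2 ≠ 0 ∧ 0 < a ∧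
        r.domain = {x | 0 < x 0 ^ 3 + (A : ℝ) * x 0 + (B : ℝ)} ∧
        Set.EqOn r.integrand (fun x => (a : ℝ) / Real.sqrt (x 0 ^ 3 + (A : ℝ) * x 0 + (B : ℝ))) r.domain ∧
        d = KZ.of r},
      KZ.eval e = 0 → e ∈ AddSubgroup.closure Summit.KontsevichZagierPeriods.XMapKernel.Negative.gens := by
  intro hHW e he he0
  refine XMapKernelRealPeriodCell.realPeriodCellKernel hHW e (AddSubgroup.closure_mono ?_ he) he0
  rintro d ⟨A, B, a, r, hΔ, -, hd, hi, rfl⟩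
  exact ⟨A, B, a, r, hΔ, hd, hi, rfl⟩

/-- **Line `axiom-saturated-sector-peeling`, remainder from the crux — unconditionally.** `KernelModElliptic`
("every kernel element is an honest RELATION modulo an element of the elliptic real-period sector") follows
from the crux with the sector element `0`, because the enlarged move group is `KZ.relations`
(`closure_gens_eq_relations_holds`). [folklore] -/
theorem kernelModElliptic_of_xMapKernel (hX : XMapKernel) :
    ∀ c : KZ.FormalRep, KZ.eval c = 0 → ∃ e ∈ AddSubgroup.closure
      {d : KZ.FormalRep | ∃ (A B : ℤ) (a : ℚ) (r : KZ.IntegralRep 1), 4 * A ^ 3 + 27 * B ^ 2 ≠ 0 ∧ 0 < a ∧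
        r.domain = {x | 0 < x 0 ^ 3 + (A : ℝ) * x 0 + (B : ℝ)} ∧
        Set.EqOn r.integrand (fun x => (a : ℝ) / Real.sqrt (x 0 ^ 3 + (A : ℝ) * x 0 + (B : ℝ))) r.domain ∧
        d = KZ.of r},
      c - e ∈ KZ.relations := by
  intro c hc
  refine ⟨0, AddSubgroup.zero_mem _, ?_⟩
  rw [sub_zero, ← closure_gens_eq_relations_holds]
  exact (crux_iff.1 hX) c hc

/-- **Line `axiom-saturated-sector-peeling`, composition** (`cardP_composition` of the ideator sketch, against
the landed cell): conditionally on `HuberWustholzManyCurvePeriods`, `KernelModElliptic` implies the crux —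
`c = (c − e) + e` with `c − e ∈ relations ≤ closure gens` and `e ∈ closure gens` by the cell (soundness gives
`eval e = 0`). [folklore] -/
theorem xMapKernel_of_kernelModElliptic :
    Literature.NumberTheory.Transcendental.HuberWustholzManyCurvePeriods →
    (∀ c : KZ.FormalRep, KZ.eval c = 0 → ∃ e ∈ AddSubgroup.closure
      {d : KZ.FormalRep | ∃ (A B : ℤ) (a : ℚ) (r : KZ.IntegralRep 1), 4 * A ^ 3 + 27 * B ^ 2 ≠ 0 ∧ 0 < a ∧
        r.domain = {x | 0 < x 0 ^ 3 + (A : ℝ) * x 0 + (B : ℝ)} ∧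
        Set.EqOn r.integrand (fun x => (a : ℝ) / Real.sqrt (x 0 ^ 3 + (A : ℝ) * x 0 + (B : ℝ))) r.domain ∧
        d = KZ.of r},
      c - e ∈ KZ.relations) → XMapKernel := by
  intro hHW hK
  rw [crux_iff]
  intro c hc
  obtain ⟨e, he, hce⟩ := hK c hc
  have hce' : c - e ∈ AddSubgroup.closure gens := relations_le_closure_gens hce
  have hdiff : KZ.eval (c - e) = 0 := AddMonoidHom.mem_ker.1 (closure_gens_le_ker_eval hce')
  have he0 : KZ.eval e = 0 := by
    rw [map_sub, hc, zero_sub, neg_eq_zero] at hdiff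
    exact hdiff
  have : c = (c - e) + e := by abel
  rw [this]
  exact AddSubgroup.add_mem _ hce' (ellipticSectorKernel hHW e he he0)

/-- **Line `axiom-saturated-sector-peeling`, remainder.** Conditionally on `HuberWustholzManyCurvePeriods`, the
line's declared remainder `KernelModElliptic` is EQUIVALENT to the summit: like every remainder of a
cell-plus-reduction line on this crux it is the Kontsevich–Zagier period conjecture itself. [folklore] -/
theorem kernelModElliptic_iff_summit : Literature.NumberTheory.Transcendental.HuberWustholzManyCurvePeriods → ((∀ c : Literature.NumberTheory.Transcendental.KZ.FormalRep, Literature.NumberTheory.Transcendental.KZ.eval c = 0 → ∃ e ∈ AddSubgroup.closure {d : Literature.NumberTheory.Transcendental.KZ.FormalRep | ∃ (A B : ℤ) (a : ℚ) (r : Literature.NumberTheory.Transcendental.KZ.IntegralRep 1), 4 * A ^ 3 + 27 * B ^ 2 ≠ 0 ∧ 0 < a ∧ r.domain = {x | 0 < x 0 ^ 3 + (A : ℝ) * x 0 + (B : ℝ)} ∧ Set.EqOn r.integrand (fun x => (a : ℝ) / Real.sqrt (x 0 ^ 3 + (A : ℝ) * x 0 + (B : ℝ))) r.domain ∧ d =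 Literature.NumberTheory.Transcendental.KZ.of r}, c - e ∈ Literature.NumberTheory.Transcendental.KZ.relations) ↔ KontsevichZagierPeriods) := fun hHW =>
  ⟨fun hK => xMapKernel_iff_summit.1 (xMapKernel_of_kernelModElliptic hHW hK),
    fun hs => kernelModElliptic_of_xMapKernel (xMapKernel_iff_summit.2 hs)⟩

end Summit.KontsevichZagierPeriods.IsogenyCertificates.XMapKernelIffSummit

end
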